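import Summits.AtomisticToContinuum.HydrodynamicLimit.Theorems.CollisionIsometryCLTCollisionalTransferLocalityBlockVelocityLLNConst
import Summits.AtomisticToContinuum.HydrodynamicLimit.Theorems.CollisionIsometryCLTCollisionalTransferLocalityGaussMarks
import HarnessLib

/-!
# The dominators of the block kinetic heat flux vanish in mean (line `hemisphere-affine-slaving`)

Support file (`--supports stmt-AtomisticToContinuum-9518`) of the lead prover of the line
`hemisphere-affine-slaving` for the crux `CollisionalTransferLocality`, landing the registered stub
`stub_blockHeatFluxDominatorConst` ([KS-q']): STATICS under the homogeneous local Gibbs law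
`G_N = localGibbsLaw σ 1 0 θ N (Φ N)` (`σ ≤ 1/2`, `θ > 0`, any flow family) for an admissible kernel
family `φ_N` (`0 ≤ φ_N ≤ C (N+1)^{3γ}`, mass one, `0 < γ ≤ 1/15`): `E ∫ₓ [T + B] dx → 0`, where
`T = Σ_a ((N+1)⁻¹ Σᵢ φᵢ |vᵢ|² v_{ia})²`, `B = |m̄|² (Ē/ρ̄)²` (`φᵢ = φ_N(xᵢ − x)`; Lean division).

Proof (no dynamics). Under `G_N` the velocities are, independently of the positions, i.i.d. centred
Maxwellians (`localGibbsMeasure_rung0_eq_map`), so `G_N` is invariant under the `2^{N+1}` partial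
velocity reflections `vᵢ ↦ εᵢ vᵢ` (`measurePreserving_vflip`) and, for the nonnegative integrand
`F = T + B`, `E ∫ₓ F = E ∫ₓ 2^{-(N+1)} Σ_ε F∘S_ε` (`lintegral` bookkeeping). The sign average kills
all cross terms (Rademacher orthogonality), `|vᵢ|, ρ̄, Ē` being even, and Jensen for the cube gives
`2^{-(N+1)} Σ_ε F∘S_ε = (N+1)⁻² [Σᵢ φᵢ²|vᵢ|⁶ + (Σᵢ φᵢ²|vᵢ|²)(Ē/ρ̄)²] ≤ (N+1)⁻² (5M/4) Σᵢ φᵢ |vᵢ|⁶`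
for `0 ≤ φ ≤ M`; the majorant integrates (`∫ₓ φ = 1`, `vᵢ ~ N(0, θ id)`) to
`(5/4) E|v|⁶ · M/(N+1) ≤ (5/4) E|v|⁶ · C (N+1)^{3γ−1} → 0`. Folklore (symmetry and moments of i.i.d.
Maxwellians; Spohn 1991, Part I §2.3 for the product structure, recorded on the imported tools).
-/

namespace Summit.AtomisticToContinuum.HydrodynamicLimit.Theorems.HemisphereAffineSlaving

open scoped BigOperators Topology Classical ENNReal InnerProductSpace
open Filter Set Function MeasureTheory

noncomputable section

open Literature.MathematicalPhysics.KineticTheory (T3 V3)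
open Literature.MathematicalPhysics.KineticTheory (gaussMeasure localGibbsLaw localGibbsLaw_eq
  localGibbsMeasure_rung0_eq_map posGibbsMeasure hsDiameter zipConfig measurable_zipConfig
  measurable_gaussShift isProbabilityMeasure_posGibbsMeasure)
open ProbabilityTheory (stdGaussian stdGaussian_map)

namespace BlockHeatFluxDominatorConst

variable {N : ℕ}

/-- The sign pattern of a set `s` of labels: `−1` on `s`, `+1` off `s`. [folklore] -/
def sgn (s : Finset (Fin (N + 1))) (i : Fin (N + 1)) : ℝ := if i ∈ s then -1 else 1

/-- Reflections preserve the speed: `|εᵢ v| = |v|`. [folklore] -/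
theorem norm_sgn_smul (s : Finset (Fin (N + 1))) (i : Fin (N + 1)) (v : V3) :
    ‖sgn s i • v‖ = ‖v‖ := by
  unfold sgn; split_ifs <;> simp

/-- Rademacher orthogonality `Σ_ε εᵢ εⱼ = 0`, `i ≠ j` (toggle the membership of `i`). [folklore] -/
theorem sum_sgn_mul_sgn {i j : Fin (N + 1)} (hij : i ≠ j) :
    ∑ s : Finset (Fin (N + 1)), sgn s i * sgn s j = 0 := by
  have hi : ∀ s : Finset (Fin (N + 1)), sgn (symmDiff s {i}) i = -sgn s i := fun s => by
    unfold sgn; by_cases h : i ∈ s <;> simp [Finset.mem_symmDiff, h]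
  have hj : ∀ s : Finset (Fin (N + 1)), sgn (symmDiff s {i}) j = sgn s j := fun s => by
    unfold sgn; simp [Finset.mem_symmDiff, hij.symm]
  have hinv : Function.Involutive fun s : Finset (Fin (N + 1)) => symmDiff s {i} := fun s =>
    symmDiff_symmDiff_cancel_right {i} s
  have h := Equiv.sum_comp (hinv.toPerm _) fun s => sgn s i * sgn s j
  simp only [Function.Involutive.coe_toPerm, hi, hj, neg_mul, Finset.sum_neg_distrib] at h
  linarith

/-- **Rademacher**: `Σ_ε (Σᵢ εᵢ aᵢ)² = 2^{N+1} Σᵢ aᵢ²` (only the diagonal survives). [folklore] -/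
theorem sum_sq_sum_sgn_mul (a : Fin (N + 1) → ℝ) :
    ∑ s : Finset (Fin (N + 1)), (∑ i, sgn s i * a i) ^ 2 =
      (Fintype.card (Finset (Fin (N + 1))) : ℝ) * ∑ i, a i ^ 2 := by
  have hexp : ∀ s : Finset (Fin (N + 1)),
      (∑ i, sgn s i * a i) ^ 2 = ∑ i, ∑ j, sgn s i * sgn s j * (a i * a j) := fun s => by
    rw [sq, Finset.sum_mul_sum]
    exact Finset.sum_congr rfl fun i _ => Finset.sum_congr rfl fun j _ => by ring
  simp_rw [hexp]
  rw [Finset.sum_comm, Finset.mul_sum]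
  refine Finset.sum_congr rfl fun i _ => ?_
  rw [Finset.sum_comm, Finset.sum_eq_single i (fun j _ hji => ?_)
    fun h => absurd (Finset.mem_univ i) h]
  · have hsq : ∀ s : Finset (Fin (N + 1)), sgn s i * sgn s i = 1 := fun s => by
      unfold sgn; split_ifs <;> norm_num
    simp_rw [hsq, one_mul]
    rw [Finset.sum_const, Finset.card_univ, nsmul_eq_mul, sq]
  · rw [← Finset.sum_mul, sum_sgn_mul_sgn (Ne.symm hji), zero_mul]

/-- `Σ_a (c v_a)² = c² |v|²` on `ℝ³`. [folklore] -/
theorem sum_sq_mul_apply (c : ℝ) (v : V3) : ∑ a, (c * v a) ^ 2 = c ^ 2 * ‖v‖ ^ 2 := by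
  rw [EuclideanSpace.real_norm_sq_eq, Finset.mul_sum]
  exact Finset.sum_congr rfl fun a _ => by ring

/-- Reflect the velocities of the particles in `s`: `vᵢ ↦ εᵢ vᵢ`, positions fixed. [folklore] -/
def vflip (s : Finset (Fin (N + 1))) (z : Cfg N) : Cfg N := fun i => ((z i).1, sgn s i • (z i).2)

/-- `vflip s` is measurable. [folklore] -/
theorem measurable_vflip (s : Finset (Fin (N + 1))) : Measurable (vflip s : Cfg N → Cfg N) :=
  measurable_pi_lambda _ fun i =>
    (measurable_pi_apply i).fst.prodMk (((measurable_pi_apply i).snd).const_smul (sgn s i))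

/-- **Partial velocity reflections preserve the homogeneous local Gibbs law** (`σ ≤ 1/2`, `θ > 0`):
`G_N = zipConfig_# (posGibbsMeasure ⊗ N(0, θ id)^{⊗(N+1)})` (`localGibbsMeasure_rung0_eq_map`),
`N(0, θ id)` is `−id`-invariant (`stdGaussian_map`), `measurePreserving_pi`, `.prod`. [folklore] -/
theorem measurePreserving_vflip {σ θ : ℝ} (hθ : 0 < θ) (hσ : σ ≤ 1 / 2) (Φ : Flows σ) (N : ℕ)
    (s : Finset (Fin (N + 1))) :
    MeasurePreserving (vflip s) (localGibbsLaw σ (fun _ => 1) (fun _ => 0) (fun _ => θ) N (Φ N))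
      (localGibbsLaw σ (fun _ => 1) (fun _ => 0) (fun _ => θ) N (Φ N)) := by
  haveI := isProbabilityMeasure_posGibbsMeasure (a₀ := fun _ : T3 => (1 : ℝ)) continuous_const
    (fun _ => one_pos) hσ N
  haveI : SFinite (posGibbsMeasure (fun _ : T3 => (1 : ℝ)) (hsDiameter σ N) (N + 1)) :=
    inferInstance
  have hneg : MeasurePreserving (fun v : V3 => -v) (gaussMeasure (0 : V3) θ)
      (gaussMeasure (0 : V3) θ) := by
    refine ⟨measurable_neg, ?_⟩
    have hL : (stdGaussian V3).map (fun w : V3 => -w) = stdGaussian V3 := by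
      have h := stdGaussian_map (LinearIsometryEquiv.neg ℝ : V3 ≃ₗᵢ[ℝ] V3)
      rwa [LinearIsometryEquiv.coe_neg] at h
    have hcomm : ((fun v : V3 => -v) ∘ fun w : V3 => (0 : V3) + Real.sqrt θ • w) =
        (fun w : V3 => (0 : V3) + Real.sqrt θ • w) ∘ fun w : V3 => -w := by
      funext w
      simp
    show ((stdGaussian V3).map _).map _ = (stdGaussian V3).map _
    rw [Measure.map_map measurable_neg (measurable_gaussShift (0 : V3) θ), hcomm,
      ← Measure.map_map (measurable_gaussShift (0 : V3) θ) measurable_neg, hL]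
  have h1 : ∀ i, MeasurePreserving (fun v : V3 => sgn s i • v) (gaussMeasure (0 : V3) θ)
      (gaussMeasure (0 : V3) θ) := fun i => by
    unfold sgn
    split_ifs
    · simpa only [neg_smul, one_smul] using hneg
    · simp only [one_smul]
      exact MeasurePreserving.id _
  have hprod := (MeasurePreserving.id
    (posGibbsMeasure (fun _ : T3 => (1 : ℝ)) (hsDiameter σ N) (N + 1))).prod
    (measurePreserving_pi (fun _ => gaussMeasure (0 : V3) θ) (fun _ => gaussMeasure (0 : V3) θ) h1)
  refine ⟨measurable_vflip s, ?_⟩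
  rw [localGibbsLaw_eq, localGibbsMeasure_rung0_eq_map σ zero_le_one hθ (0 : V3) N,
    Measure.map_map (measurable_vflip s) measurable_zipConfig,
    show (vflip s ∘ zipConfig : (Fin (N + 1) → T3) × (Fin (N + 1) → V3) → Cfg N) =
      zipConfig ∘ Prod.map id (fun (vs : Fin (N + 1) → V3) (i : Fin (N + 1)) => sgn s i • vs i)
      from funext fun _ => rfl,
    ← Measure.map_map measurable_zipConfig hprod.measurable, hprod.map_eq]

/-- The cubic dominator `T = Σ_a ((N+1)⁻¹ Σᵢ φ(xᵢ − x) |vᵢ|² v_{ia})²` (registered). [folklore] -/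
def Tm (φ : ℕ → T3 → ℝ) (N : ℕ) (z : Cfg N) (x : T3) : ℝ :=
  ∑ a : Fin 3, (((N : ℝ) + 1)⁻¹ *
    ∑ i : Fin (N + 1), φ N ((z i).1 - x) * (‖(z i).2‖ ^ 2 * (z i).2 a)) ^ 2

/-- The registered integrand `F = T + |m̄|² (Ē/ρ̄)²`. [folklore] -/
def F (φ : ℕ → T3 → ℝ) (N : ℕ) (z : Cfg N) (x : T3) : ℝ :=
  Tm φ N z x + ‖mB φ N z x‖ ^ 2 * (EB φ N z x / rhoB φ N z x) ^ 2

/-- Sign average of `|m̄|²` (odd marks `v_a`): `Σ_ε |m̄(S_ε z)|² = 2^{N+1} (N+1)⁻² Σᵢ φᵢ² |vᵢ|²`.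
[folklore] -/
theorem sum_norm_mB_vflip_sq (φ : ℕ → T3 → ℝ) (z : Cfg N) (x : T3) :
    ∑ s : Finset (Fin (N + 1)), ‖mB φ N (vflip s z) x‖ ^ 2 =
      (Fintype.card (Finset (Fin (N + 1))) : ℝ) *
        ∑ i, (((N + 1 : ℕ) : ℝ)⁻¹ * φ N ((z i).1 - x)) ^ 2 * ‖(z i).2‖ ^ 2 := by
  have h1 : ∀ s : Finset (Fin (N + 1)), ‖mB φ N (vflip s z) x‖ ^ 2 =
      ∑ a, (∑ i, sgn s i * (((N + 1 : ℕ) : ℝ)⁻¹ * φ N ((z i).1 - x) * (z i).2 a)) ^ 2 := fun s => by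
    rw [EuclideanSpace.real_norm_sq_eq]
    refine Finset.sum_congr rfl fun a _ => congrArg (· ^ 2) ?_
    rw [BlockVelocityLLNConst.mB_apply, Finset.mul_sum]
    exact Finset.sum_congr rfl fun i _ => by simp only [vflip, PiLp.smul_apply, smul_eq_mul]; ring
  simp_rw [h1]
  rw [Finset.sum_comm]
  simp_rw [sum_sq_sum_sgn_mul]
  rw [← Finset.mul_sum, Finset.sum_comm]
  simp_rw [sum_sq_mul_apply]

/-- Sign average of `T` (odd marks `|v|² v_a`): `Σ_ε T(S_ε z) = 2^{N+1} (N+1)⁻² Σᵢ φᵢ² |vᵢ|⁶`.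
[folklore] -/
theorem sum_Tm_vflip (φ : ℕ → T3 → ℝ) (z : Cfg N) (x : T3) :
    ∑ s : Finset (Fin (N + 1)), Tm φ N (vflip s z) x =
      (Fintype.card (Finset (Fin (N + 1))) : ℝ) *
        ∑ i, (((N : ℝ) + 1)⁻¹ * (φ N ((z i).1 - x) * ‖(z i).2‖ ^ 2)) ^ 2 * ‖(z i).2‖ ^ 2 := by
  have key : ∀ (s : Finset (Fin (N + 1))) (a : Fin 3),
      ((N : ℝ) + 1)⁻¹ * ∑ i, φ N ((vflip s z i).1 - x) *
          (‖(vflip s z i).2‖ ^ 2 * (vflip s z i).2 a) =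
        ∑ i, sgn s i * (((N : ℝ) + 1)⁻¹ * (φ N ((z i).1 - x) * ‖(z i).2‖ ^ 2) * (z i).2 a) :=
    fun s a => by
      rw [Finset.mul_sum]
      exact Finset.sum_congr rfl fun i _ => by
        simp only [vflip, norm_sgn_smul, PiLp.smul_apply, smul_eq_mul]; ring
  simp only [Tm, key]
  rw [Finset.sum_comm]
  simp_rw [sum_sq_sum_sgn_mul]
  rw [← Finset.mul_sum, Finset.sum_comm]
  simp_rw [sum_sq_mul_apply]

/-- **Jensen for the cube.** For weights `0 ≤ wᵢ ≤ M`, values `tᵢ ≥ 0`, `c > 0` and the weighted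
mean `R = (c Σ wᵢ tᵢ/2)/(c Σ wᵢ)` (Lean division): `(Σᵢ (c wᵢ)² tᵢ) R² ≤ c² (M/4) Σᵢ wᵢ tᵢ³`, from
`wᵢ² ≤ M wᵢ` and `(Σ wᵢtᵢ)³ ≤ (Σ wᵢ)² Σ wᵢtᵢ³` (`Real.pow_arith_mean_le_arith_mean_pow`).
[folklore] -/
theorem ratio_sq_mul_sum_le {n : ℕ} (w t : Fin n → ℝ) {M c : ℝ} (hw0 : ∀ i, 0 ≤ w i)
    (hwM : ∀ i, w i ≤ M) (ht : ∀ i, 0 ≤ t i) (hc : 0 < c) :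
    (∑ i, (c * w i) ^ 2 * t i) * ((c * ∑ i, w i * (t i / 2)) / (c * ∑ i, w i)) ^ 2 ≤
      c ^ 2 * (M / 4 * ∑ i, w i * t i ^ 3) := by
  by_cases hS : ∑ i, w i = 0
  · have hw : ∀ i, w i = 0 := fun i =>
      (Finset.sum_eq_zero_iff_of_nonneg fun j _ => hw0 j).1 hS i (Finset.mem_univ i)
    simp [hw]
  obtain ⟨k, -, -⟩ := Finset.exists_ne_zero_of_sum_ne_zero hS
  have hM : 0 ≤ M := (hw0 k).trans (hwM k)
  have hSpos : 0 < ∑ i, w i := lt_of_le_of_ne (Finset.sum_nonneg fun i _ => hw0 i) (Ne.symm hS)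
  set S := ∑ i, w i with hSdef
  set A := ∑ i, w i * t i with hAdef
  have hR : (c * ∑ i, w i * (t i / 2)) / (c * S) = A / (2 * S) := by
    rw [mul_div_mul_left _ _ hc.ne', ← div_div]
    congr 1
    rw [hAdef, Finset.sum_div]
    exact Finset.sum_congr rfl fun i _ => by ring
  have hJ : A ^ 3 ≤ S ^ 2 * ∑ i, w i * t i ^ 3 := by
    have h := Real.pow_arith_mean_le_arith_mean_pow Finset.univ (fun i => w i / S) t
      (fun i _ => div_nonneg (hw0 i) hSpos.le) (by rw [← Finset.sum_div, div_self hS])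
      (fun i _ => ht i) 3
    have e : ∀ u : Fin n → ℝ, ∑ i, w i / S * u i = (∑ i, w i * u i) / S := fun u => by
      rw [Finset.sum_div]
      exact Finset.sum_congr rfl fun i _ => by ring
    rw [e, e, div_pow, div_le_div_iff₀ (pow_pos hSpos 3) hSpos] at h
    exact le_of_mul_le_mul_right (h.trans_eq (by ring)) hSpos
  have h2 : ∑ i, (c * w i) ^ 2 * t i ≤ c ^ 2 * (M * A) := by
    rw [hAdef, Finset.mul_sum, Finset.mul_sum]
    refine Finset.sum_le_sum fun i _ => ?_
    have hi : w i * (w i * t i) ≤ M * (w i * t i) :=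
      mul_le_mul_of_nonneg_right (hwM i) (mul_nonneg (hw0 i) (ht i))
    calc (c * w i) ^ 2 * t i = c ^ 2 * (w i * (w i * t i)) := by ring
      _ ≤ c ^ 2 * (M * (w i * t i)) := mul_le_mul_of_nonneg_left hi (sq_nonneg c)
  rw [hR]
  calc (∑ i, (c * w i) ^ 2 * t i) * (A / (2 * S)) ^ 2
      ≤ c ^ 2 * (M * A) * (A / (2 * S)) ^ 2 := mul_le_mul_of_nonneg_right h2 (sq_nonneg _)
    _ = c ^ 2 * (M / 4) * (A ^ 3 / S ^ 2) := by
        field_simp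
        ring
    _ ≤ c ^ 2 * (M / 4) * ∑ i, w i * t i ^ 3 :=
        mul_le_mul_of_nonneg_left
          ((div_le_iff₀ (pow_pos hSpos 2)).2 (hJ.trans_eq (mul_comm _ _))) (by positivity)
    _ = c ^ 2 * (M / 4 * ∑ i, w i * t i ^ 3) := by ring

/-- **Pointwise bound on the sign average** (`0 ≤ φ ≤ M`; `ρ̄, Ē` even, the two sign averages,
`φᵢ² ≤ M φᵢ`, `ratio_sq_mul_sum_le`): `Σ_ε F(S_ε z, x) ≤ 2^{N+1} (N+1)⁻² (5M/4) Σᵢ φ(xᵢ − x) |vᵢ|⁶`.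
[folklore] -/
theorem sum_F_vflip_le {φ : ℕ → T3 → ℝ} (hφ0 : ∀ y, 0 ≤ φ N y) {M : ℝ} (hφM : ∀ y, φ N y ≤ M)
    (z : Cfg N) (x : T3) :
    ∑ s : Finset (Fin (N + 1)), F φ N (vflip s z) x ≤
      (Fintype.card (Finset (Fin (N + 1))) : ℝ) * (((N : ℝ) + 1)⁻¹ ^ 2 * (5 / 4 * M)) *
        ∑ i, φ N ((z i).1 - x) * (‖(z i).2‖ ^ 2) ^ 3 := by
  have hn : ((N + 1 : ℕ) : ℝ) = (N : ℝ) + 1 := by push_cast; ring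
  have hK : (0 : ℝ) ≤ Fintype.card (Finset (Fin (N + 1))) := Nat.cast_nonneg _
  have h1 : ∑ i, (((N : ℝ) + 1)⁻¹ * (φ N ((z i).1 - x) * ‖(z i).2‖ ^ 2)) ^ 2 * ‖(z i).2‖ ^ 2 ≤
      ((N : ℝ) + 1)⁻¹ ^ 2 * (M * ∑ i, φ N ((z i).1 - x) * (‖(z i).2‖ ^ 2) ^ 3) := by
    rw [Finset.mul_sum, Finset.mul_sum]
    refine Finset.sum_le_sum fun i _ => ?_
    have hφ := hφ0 ((z i).1 - x)
    calc (((N : ℝ) + 1)⁻¹ * (φ N ((z i).1 - x) * ‖(z i).2‖ ^ 2)) ^ 2 * ‖(z i).2‖ ^ 2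
        = ((N : ℝ) + 1)⁻¹ ^ 2 * (φ N ((z i).1 - x) *
            (φ N ((z i).1 - x) * (‖(z i).2‖ ^ 2) ^ 3)) := by ring
      _ ≤ ((N : ℝ) + 1)⁻¹ ^ 2 * (M * (φ N ((z i).1 - x) * (‖(z i).2‖ ^ 2) ^ 3)) :=
          mul_le_mul_of_nonneg_left
            (mul_le_mul_of_nonneg_right (hφM _) (by positivity)) (sq_nonneg _)
  -- the `B`-part: `(Σᵢ (N+1)⁻² φᵢ² |vᵢ|²)(Ē/ρ̄)² ≤ (N+1)⁻² (M/4) Σᵢ φᵢ |vᵢ|⁶`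
  have h2 : (∑ i, (((N + 1 : ℕ) : ℝ)⁻¹ * φ N ((z i).1 - x)) ^ 2 * ‖(z i).2‖ ^ 2) *
      (EB φ N z x / rhoB φ N z x) ^ 2 ≤
      ((N + 1 : ℕ) : ℝ)⁻¹ ^ 2 * (M / 4 * ∑ i, φ N ((z i).1 - x) * (‖(z i).2‖ ^ 2) ^ 3) := by
    rw [EB_eq, rhoB_eq]
    exact ratio_sq_mul_sum_le (fun i => φ N ((z i).1 - x)) (fun i => ‖(z i).2‖ ^ 2)
      (fun i => hφ0 _) (fun i => hφM _) (fun i => sq_nonneg _) (by positivity)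
  rw [hn] at h2
  have hρ : ∀ s, rhoB φ N (vflip s z) x = rhoB φ N z x := fun s => by simp only [rhoB_eq, vflip]
  have hE : ∀ s, EB φ N (vflip s z) x = EB φ N z x := fun s => by
    simp only [EB_eq, vflip, norm_sgn_smul]
  simp only [F, hρ, hE, Finset.sum_add_distrib, ← Finset.sum_mul]
  rw [sum_Tm_vflip, sum_norm_mB_vflip_sq, hn]
  linarith [mul_le_mul_of_nonneg_left (add_le_add h1 h2) hK]

/-- **The majorant integrates to a sixth moment**: `∫ dG_N ∫ₓ K Σᵢ φ(xᵢ − x) |vᵢ|⁶ = (N+1) K E|v|⁶`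
for a continuous kernel `φ ≥ 0` of mass one and `K ≥ 0` (`∫ₓ φ(xᵢ − x) dx = 1` by invariance of Haar
measure, `vᵢ ~ N(0, θ id)` by `measurePreserving_vel_localGibbsLaw_const`, `E|v|⁶ < ∞`).
[folklore] -/
theorem lintegral_majorant {σ θ : ℝ} (hθ : 0 < θ) (hσ : σ ≤ 1 / 2) (Φ : Flows σ) (N : ℕ)
    {φ : ℕ → T3 → ℝ} (hφc : Continuous (φ N)) (hφ0 : ∀ y, 0 ≤ φ N y) (hφ1 : ∫ y, φ N y = 1)
    {K : ℝ} (hK : 0 ≤ K) :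
    ∫⁻ z, (∫⁻ x : T3, ENNReal.ofReal (K * ∑ i, φ N ((z i).1 - x) * (‖(z i).2‖ ^ 2) ^ 3))
        ∂(localGibbsLaw σ (fun _ => 1) (fun _ => 0) (fun _ => θ) N (Φ N)) =
      ENNReal.ofReal (((N : ℝ) + 1) * (K * ∫ v, (‖v‖ ^ 2) ^ 3 ∂(gaussMeasure (0 : V3) θ))) := by
  haveI : (volume : Measure T3).IsNegInvariant :=
    Measure.IsAddHaarMeasure.isNegInvariant_of_regular _
  have hm6 : Integrable (fun v : V3 => (‖v‖ ^ 2) ^ 3) (gaussMeasure (0 : V3) θ) :=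
    (memLp_two_norm_pow_gaussMeasure_zero θ 3).integrable_sq.congr
      (ae_of_all _ fun v => by show (‖v‖ ^ 3) ^ 2 = (‖v‖ ^ 2) ^ 3; ring)
  have hinner : ∀ z : Cfg N,
      ∫⁻ x : T3, ENNReal.ofReal (K * ∑ i, φ N ((z i).1 - x) * (‖(z i).2‖ ^ 2) ^ 3) =
        ∑ i, ENNReal.ofReal (K * (‖(z i).2‖ ^ 2) ^ 3) := by
    intro z
    have hint : ∀ i, Integrable (fun x : T3 => φ N ((z i).1 - x) * (‖(z i).2‖ ^ 2) ^ 3) :=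
      fun i => Continuous.integrable_unitAddTorus (by fun_prop)
    rw [← ofReal_integral_eq_lintegral_ofReal
      ((integrable_finsetSum _ fun i _ => hint i).const_mul K)
      (ae_of_all _ fun x => mul_nonneg hK (Finset.sum_nonneg fun i _ =>
        mul_nonneg (hφ0 _) (by positivity))),
      integral_const_mul, integral_finsetSum _ fun i _ => hint i, Finset.mul_sum,
      ENNReal.ofReal_sum_of_nonneg fun i _ => mul_nonneg hK (integral_nonneg fun x =>
        mul_nonneg (hφ0 _) (by positivity))]
    refine Finset.sum_congr rfl fun i _ => ?_
    rw [integral_mul_const, integral_sub_left_eq_self (φ N) volume (z i).1, hφ1, one_mul]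
  simp_rw [hinner]
  rw [lintegral_finsetSum Finset.univ
    (f := fun i (z : Cfg N) => ENNReal.ofReal (K * (‖(z i).2‖ ^ 2) ^ 3)) fun i _ =>
    (measurable_const.mul
      (((measurable_pi_apply i).snd.norm.pow_const 2).pow_const 3)).ennreal_ofReal]
  have hi : ∀ i : Fin (N + 1), ∫⁻ z, ENNReal.ofReal (K * (‖(z i).2‖ ^ 2) ^ 3)
      ∂(localGibbsLaw σ (fun _ => 1) (fun _ => 0) (fun _ => θ) N (Φ N)) =
      ENNReal.ofReal (K * ∫ v, (‖v‖ ^ 2) ^ 3 ∂(gaussMeasure (0 : V3) θ)) := by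
    intro i
    have hf : Measurable fun v : V3 => ENNReal.ofReal (K * (‖v‖ ^ 2) ^ 3) :=
      (measurable_const.mul ((measurable_norm.pow_const 2).pow_const 3)).ennreal_ofReal
    rw [(measurePreserving_vel_localGibbsLaw_const one_pos hθ hσ 0 Φ N i).lintegral_comp hf,
      ← ofReal_integral_eq_lintegral_ofReal (hm6.const_mul K)
        (ae_of_all _ fun v => by positivity), integral_const_mul]
  simp_rw [hi]
  rw [Finset.sum_const, Finset.card_univ, Fintype.card_fin, nsmul_eq_mul,
    ENNReal.ofReal_mul (by positivity : (0 : ℝ) ≤ (N : ℝ) + 1), ← ENNReal.ofReal_natCast]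
  push_cast
  rfl

/-- **Per-`N` bound** `E ∫ₓ [T + |m̄|²(Ē/ρ̄)²] ≤ (N+1)⁻¹ M (5/4) E|v|⁶` under the homogeneous local
Gibbs law (`σ ≤ 1/2`, `θ > 0`) for a continuous kernel `0 ≤ φ_N ≤ M` of mass one (average over the
`2^{N+1}` law-preserving reflections, `sum_F_vflip_le`, `lintegral_majorant`). [folklore] -/
theorem lintegral_F_le {σ θ : ℝ} (hθ : 0 < θ) (hσ : σ ≤ 1 / 2) (Φ : Flows σ) (N : ℕ)
    {φ : ℕ → T3 → ℝ} (hφc : Continuous (φ N)) (hφ0 : ∀ y, 0 ≤ φ N y) {M : ℝ}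
    (hφM : ∀ y, φ N y ≤ M) (hφ1 : ∫ y, φ N y = 1) :
    ∫⁻ z, (∫⁻ x : T3, ENNReal.ofReal (F φ N z x))
        ∂(localGibbsLaw σ (fun _ => 1) (fun _ => 0) (fun _ => θ) N (Φ N)) ≤
      ENNReal.ofReal (((N : ℝ) + 1)⁻¹ * M *
        (5 / 4 * ∫ v, (‖v‖ ^ 2) ^ 3 ∂(gaussMeasure (0 : V3) θ))) := by
  set P := localGibbsLaw σ (fun _ => (1 : ℝ)) (fun _ => (0 : V3)) (fun _ => θ) N (Φ N) with hP
  haveI : ∀ i : Fin (N + 1), BorelSpace (T3 × V3) := fun _ => Prod.borelSpace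
  have hM : 0 ≤ M := (hφ0 0).trans (hφM 0)
  -- joint measurability of the integrand
  have hFu : Measurable
      (Function.uncurry fun (z : Cfg N) (x : T3) => ENNReal.ofReal (F φ N z x)) := by
    have hT : Measurable fun p : Cfg N × T3 => Tm φ N p.1 p.2 := by
      unfold Tm
      fun_prop
    have hB : Measurable fun p : Cfg N × T3 =>
        ‖mB φ N p.1 p.2‖ ^ 2 * (EB φ N p.1 p.2 / rhoB φ N p.1 p.2) ^ 2 :=
      ((continuous_mB hφc).measurable.norm.pow_const 2).mul
        (((continuous_EB hφc).measurable.div (continuous_rhoB hφc).measurable).pow_const 2)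
    exact (hT.add hB).ennreal_ofReal
  have hIn : Measurable fun z : Cfg N => ∫⁻ x : T3, ENNReal.ofReal (F φ N z x) :=
    hFu.lintegral_prod_right
  set Kc : ℝ≥0∞ := (Fintype.card (Finset (Fin (N + 1))) : ℝ≥0∞) with hKc
  -- averaging over the reflections
  have hstep : Kc * ∫⁻ z, (∫⁻ x : T3, ENNReal.ofReal (F φ N z x)) ∂P =
      ∫⁻ z, (∫⁻ x : T3, ENNReal.ofReal (∑ s : Finset (Fin (N + 1)), F φ N (vflip s z) x)) ∂P :=
    calc Kc * ∫⁻ z, (∫⁻ x : T3, ENNReal.ofReal (F φ N z x)) ∂P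
        = ∑ s : Finset (Fin (N + 1)),
            ∫⁻ z, (∫⁻ x : T3, ENNReal.ofReal (F φ N (vflip s z) x)) ∂P := by
          rw [Finset.sum_congr rfl fun s _ =>
            (measurePreserving_vflip hθ hσ Φ N s).lintegral_comp hIn,
            Finset.sum_const, Finset.card_univ, nsmul_eq_mul]
      _ = ∫⁻ z, ∑ s : Finset (Fin (N + 1)),
            (∫⁻ x : T3, ENNReal.ofReal (F φ N (vflip s z) x)) ∂P :=
          (lintegral_finsetSum _ fun s _ => hIn.comp (measurable_vflip s)).symm
      _ = _ := lintegral_congr fun z => by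
          rw [← lintegral_finsetSum Finset.univ
            (f := fun s (x : T3) => ENNReal.ofReal (F φ N (vflip s z) x)) fun s _ =>
            hFu.of_uncurry_left]
          exact lintegral_congr fun x =>
            (ENNReal.ofReal_sum_of_nonneg fun s _ => by unfold F Tm; positivity).symm
  -- the pointwise bound, integrated
  refine (ENNReal.mul_le_mul_iff_right (Nat.cast_ne_zero.2 Fintype.card_ne_zero)
    (ENNReal.natCast_ne_top _)).1 (hstep.trans_le ((lintegral_mono fun z =>
    lintegral_mono fun x => ENNReal.ofReal_le_ofReal (sum_F_vflip_le hφ0 hφM z x)).trans_eq ?_))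
  rw [lintegral_majorant hθ hσ Φ N hφc hφ0 hφ1 (by positivity), ← ENNReal.ofReal_natCast,
    ← ENNReal.ofReal_mul (Nat.cast_nonneg _)]
  congr 1
  field_simp

end BlockHeatFluxDominatorConst

open BlockHeatFluxDominatorConst in
/-- **Registered stub `stub_blockHeatFluxDominatorConst` ([KS-q'], line `hemisphere-affine-slaving`,
crux stmt-AtomisticToContinuum-9518): the two dominators of the block kinetic heat flux vanish in
mean under the homogeneous local Gibbs law `G_N = localGibbsLaw σ 1 0 θ N (Φ N)`** (`0 < σ ≤ 1/2`,
`θ > 0`, any flow family, admissible kernels at mesoscale `(N+1)^{-γ}`, `0 < γ ≤ 1/15`):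
`E_{G_N} ∫ₓ [Σ_a ((N+1)⁻¹ Σᵢ φᵢ |vᵢ|² v_{ia})² + |m̄|² (Ē/ρ̄)²] dx ≤ (5/4) E|v|⁶ C (N+1)^{3γ−1} → 0`
(`lintegral_F_le`: law-preserving velocity reflections, Rademacher, Jensen). [folklore] -/
theorem stub_blockHeatFluxDominatorConst : ∀ σ : ℝ, 0 < σ → σ ≤ 1 / 2 → ∀ θ : ℝ, 0 < θ → ∀ (Φ : Flows σ) (γ C : ℝ) (φ : ℕ → T3 → ℝ), 0 < γ → γ ≤ 1 / 15 → AdmissibleKernel γ C φ → Tendsto (fun N : ℕ => ∫⁻ z, (∫⁻ x : T3, ENNReal.ofReal ((∑ a : Fin 3, (((N : ℝ) + 1)⁻¹ * ∑ i : Fin (N + 1), φ N ((z i).1 - x) * (‖(z i).2‖ ^ 2 * (z i).2 a)) ^ 2) + ‖mB φ N z x‖ ^ 2 * (EB φ N z x / rhoB φ N z x) ^ 2)) ∂(Literature.MathematicalPhysics.KineticTheory.localGibbsLaw σ (fun _ => 1) (fun _ => 0) (fun _ => θ) N (Φ N))) atTop (𝓝 0) := by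
  intro σ _hσ0 hσ θ hθ Φ γ C φ _hγ hγ hK
  have hφc : ∀ N, Continuous (φ N) := fun N => (hK.1 N).continuous
  have hφM : ∀ (N : ℕ) y, φ N y ≤ C * ((N : ℝ) + 1) ^ (3 * γ) := hK.2.2.2.2.1
  -- the Gaussian constant `(5/4) E|v|⁶`
  set m6 : ℝ := 5 / 4 * ∫ v, (‖v‖ ^ 2) ^ 3 ∂(gaussMeasure (0 : V3) θ) with hm6
  refine tendsto_of_tendsto_of_tendsto_of_le_of_le tendsto_const_nhds
    (BlockVelocityLLNConst.tendsto_ofReal_mul_rpow hγ (C * m6)) (fun _ => zero_le) fun N => ?_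
  refine (lintegral_F_le hθ hσ Φ N (hφc N) (hK.2.1 N) (hφM N) (hK.2.2.1 N)).trans (le_of_eq ?_)
  rw [← hm6, Real.rpow_sub_one (by positivity) (3 * γ)]
  congr 1
  field_simp

end

end Summit.AtomisticToContinuum.HydrodynamicLimit.Theorems.HemisphereAffineSlaving
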